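/-
Copyright (c) 2026. All rights reserved.
Released under Apache 2.0 license as described in the file LICENSE.
Authors: abc-iut cell, seat abc-iut-w6-d027 (gen 2; row «TEMPERED-OPENAUG-GLUE», L4 lane).
-/
import Literature.AnabelianGeometry.AbsoluteAnabelian.MonoidKummerMapsTLGLiftOpenAugProofs
import Literature.AnabelianGeometry.SemiGraphs.TemperedOpenMapping
import HarnessLib

/-!
# [AbsTopIII] Prop 3.2 (iv) / 3.3 (ii): the lifting sentences for TEMPERED `Π`, UNCONDITIONALLY
# (the open mapping theorem for tempered groups supplies the open augmentation)

Proof-only companion (theorems only, no new definitions) of abc-iut-L4-t2's `MonoidKummerMaps.lean` and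
of abc-iut-L6-t13's `MonoidKummerMapsTLGLiftOpenAugProofs.lean` (S. Mochizuki, *Topics in Absolute
Anabelian Geometry III*, Def. 3.1 (i)/(ii) pp. 66–67, Prop. 3.2 (iv) p. 72, Prop. 3.3 (ii) p. 74; kurims
manuscript, lit key `paper:url-5493eb38cbb7`; S. Mochizuki, *Semi-graphs of anabelioids*, Def. 3.1 (i)
p. 33 and Example 3.10 p. 43).

`MonoidKummerMapsTLGLiftOpenAugProofs.lean` proves the `TLG`/`TCG`/`TM` lifting sentences and the
schemata `GaloisIsoLiftsToTMPairIso H` (F-0409), `UnitPairIsoFibresOfType H` (F-0413) for every pair /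
every hypothesis predicate `H` whose models have OPEN Galois augmentation `ε_k : Π_k ↠ G_k` (print's
"the quotient `Π_k ↠ G_k`", Def. 3.1 (i) p. 67).  For the pairs that [IUTchI–III] actually feed into this
machinery at bad places the group `Π` is a TEMPERED fundamental group — pro-discrete, not σ-compact — so
neither compactness (`MonoidKummerMapsTLGLiftCompactProofs.lean`) nor the σ-compact open mapping theorem
(`MonoidKummerMapsTLGLiftSigmaCompactProofs.lean`) applies.  The tree's open mapping theorem for
TEMPERED groups ([SemiAnbd] Ex. 3.10 made a theorem by `SemiGraphs.IsTempered.isOpenMap_of_surjective`,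
`TemperedOpenMapping.lean`: a continuous surjective homomorphism from a tempered group with
first-countable topology onto a Hausdorff Baire group is open) closes exactly this case:

* `ModelMLFGaloisData.isOpenMap_aug_of_isTempered` — model data whose `Π_k` is tempered ([SemiAnbd]
  Def. 3.1 (i), the tree's complete inverse-limit form `SemiGraphs.IsTempered`) with first-countable
  topology have OPEN `ε_k` (`G_k = Gal(k̄/k)` is compact Hausdorff, hence Baire);
* `ModelMLFGaloisData.isOpenMap_aug_of_continuousMulEquiv_isTempered` — the same for ANY model whose
  `Π_k` is isomorphic, as a topological group, to a tempered first-countable group (apply the theorem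
  to `ε_k ∘ e⁻¹`; no transport of `IsTempered` along the isomorphism is needed);
* `isOpenMap_aug_of_tmPair_iso_of_isTempered`, `…tcgPair…`, `…tlgPair…` — every `TM`/`TCG`/`TLG`-model of
  an abstract pair `(Π ↷ M)` with tempered first-countable `Π` has open augmentation;
* `tlgLifting_isTempered_holds`, `tcgLifting_isTempered_holds`, `unitPairIsoFibres_tlg_isTempered_holds`,
  and the schema closers `galoisIsoLiftsToTMPairIso_of_isTempered_holds H` (F-0409),
  `unitPairIsoFibresOfType_of_isTempered_holds H` (F-0413) for EVERY hypothesis predicate `H` under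
  which `Π` is tempered with first-countable topology — one `exact` each over abc-iut-L6-t13's
  open-augmentation theorems.

* §5 (appended): the same closers for hypothesis predicates under which `Π` is merely ISOMORPHIC (as a
  topological group) to a tempered first-countable group — `…_of_continuousMulEquiv_isTempered_holds` —
  the shape in which [IUTchI]'s bad-place pairs present themselves (`P.Pi ≃ₜ* Π^tp_X`).

Since every profinite group is tempered (`SemiGraphs.IsTempered.of_profinite`, [SemiAnbd] Rmk. 3.1.1),
the first-countable profinite case (étale fundamental groups of hyperbolic orbicurves over an MLF) is an
instance as well.

HONEST FRAMING: an INSTANCE form of the frozen facts F-0409 / F-0413 (FACT-LIST rule R5) at the tempered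
predicates; OUR kernel check of classical topological-group plumbing ([SemiAnbd] Ex. 3.10 + local class
field theory already in the tree); nothing here bears on [IUTchIII] Cor. 3.12 or asserts anything about
abc; typed ≠ proved except for the theorems of this file.
-/

noncomputable section

open scoped nonZeroDivisors

namespace Literature.AnabelianGeometry.AbsoluteAnabelian

/-! ### §1. Model level: tempered `Π_k` ⇒ `ε_k` open -/

section Model

variable {C : MLFClosure.{0}} (D : ModelMLFGaloisData C.k C.K)

/-- For model data whose `Π_k` is TEMPERED ([SemiAnbd] Def. 3.1 (i)) with first-countable topology the
augmentation `ε_k : Π_k ↠ Gal(k̄/k)` is an OPEN map: the open mapping theorem for tempered groups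
([SemiAnbd] Ex. 3.10, `SemiGraphs.IsTempered.isOpenMap_of_surjective`) applied to the continuous
surjection `ε_k` onto the compact Hausdorff — hence Baire — group `Gal(k̄/k)`.
[cite: MochizukiAbsTopIII2015, Definition 3.1 (i) p.66] [cite: MochizukiSemiAnbd2006, Ex 3.10 p.43] -/
theorem ModelMLFGaloisData.isOpenMap_aug_of_isTempered [FirstCountableTopology D.Pi]
    (hT : SemiGraphs.IsTempered D.Pi) : IsOpenMap D.aug := by
  haveI : IsGalois C.k C.K := {}
  haveI : CompactSpace (C.K ≃ₐ[C.k] C.K) := inferInstance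
  haveI : T2Space (C.K ≃ₐ[C.k] C.K) := inferInstance
  haveI : BaireSpace (C.K ≃ₐ[C.k] C.K) := BaireSpace.of_t2Space_locallyCompactSpace
  exact hT.isOpenMap_of_surjective D.aug D.continuous_aug D.aug_surjective

/-- For model data whose `Π_k` is ISOMORPHIC, as a topological group, to a tempered group `Π` with
first-countable topology, `ε_k` is an open map: `ε_k ∘ e⁻¹ : Γ ↠ Gal(k̄/k)` is a continuous surjective
homomorphism from a tempered group, hence open, and `ε_k = (ε_k ∘ e⁻¹) ∘ e` with `e` a homeomorphism.
(No transport of the tempered property along `e` is needed.)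
[cite: MochizukiAbsTopIII2015, Definition 3.1 (ii) p.67] [cite: MochizukiSemiAnbd2006, Ex 3.10 p.43] -/
theorem ModelMLFGaloisData.isOpenMap_aug_of_continuousMulEquiv_isTempered {Γ : Type} [Group Γ]
    [TopologicalSpace Γ] [IsTopologicalGroup Γ] [FirstCountableTopology Γ]
    (hT : SemiGraphs.IsTempered Γ) (e : D.Pi ≃ₜ* Γ) : IsOpenMap D.aug := by
  haveI : IsGalois C.k C.K := {}
  haveI : CompactSpace (C.K ≃ₐ[C.k] C.K) := inferInstance
  haveI : T2Space (C.K ≃ₐ[C.k] C.K) := inferInstance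
  haveI : BaireSpace (C.K ≃ₐ[C.k] C.K) := BaireSpace.of_t2Space_locallyCompactSpace
  set f : Γ →* (C.K ≃ₐ[C.k] C.K) := D.aug.comp e.symm.toMulEquiv.toMonoidHom with hfdef
  have hfc : Continuous f := D.continuous_aug.comp e.symm.continuous
  have hfs : Function.Surjective f := D.aug_surjective.comp e.symm.surjective
  have hfo : IsOpenMap f := hT.isOpenMap_of_surjective f hfc hfs
  have heq : (D.aug : D.Pi → (C.K ≃ₐ[C.k] C.K)) = f ∘ e := by
    funext g
    show D.aug g = D.aug (e.symm (e g))
    rw [ContinuousMulEquiv.symm_apply_apply]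
  rw [heq]
  exact hfo.comp e.toHomeomorph.isOpenMap

end Model

/-! ### §2. Pair level: the models of a pair with tempered `Π` have open augmentation -/

/-- Every `TM`-model of an abstract pair `(Π ↷ M)` whose `Π` is tempered with first-countable topology
has open Galois augmentation. [cite: MochizukiAbsTopIII2015, Definition 3.1 (ii) p.67] -/
theorem isOpenMap_aug_of_tmPair_iso_of_isTempered (P : GaloisMonoidPair.{0})
    [FirstCountableTopology P.Pi] (hT : SemiGraphs.IsTempered P.Pi)
    (C : MLFClosure.{0}) (D : ModelMLFGaloisData C.k C.K)
    (h : Nonempty (GaloisMonoidPair.Iso D.tmPair P)) : IsOpenMap D.aug := by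
  obtain ⟨ι⟩ := h
  exact D.isOpenMap_aug_of_continuousMulEquiv_isTempered hT ι.isoPi

/-- Every `TCG`-model of an abstract pair `(Π ↷ M)` whose `Π` is tempered with first-countable topology
has open Galois augmentation. [cite: MochizukiAbsTopIII2015, Definition 3.1 (ii) p.67] -/
theorem isOpenMap_aug_of_tcgPair_iso_of_isTempered (P : GaloisMonoidPair.{0})
    [FirstCountableTopology P.Pi] (hT : SemiGraphs.IsTempered P.Pi)
    (C : MLFClosure.{0}) (D : ModelMLFGaloisData C.k C.K)
    (h : Nonempty (GaloisMonoidPair.Iso D.tcgPair P)) : IsOpenMap D.aug := by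
  obtain ⟨ι⟩ := h
  exact D.isOpenMap_aug_of_continuousMulEquiv_isTempered hT ι.isoPi

/-- Every `TLG`-model of an abstract pair `(Π ↷ M)` whose `Π` is tempered with first-countable topology
has open Galois augmentation. [cite: MochizukiAbsTopIII2015, Definition 3.1 (ii) p.67] -/
theorem isOpenMap_aug_of_tlgPair_iso_of_isTempered (P : GaloisMonoidPair.{0})
    [FirstCountableTopology P.Pi] (hT : SemiGraphs.IsTempered P.Pi)
    (C : MLFClosure.{0}) (D : ModelMLFGaloisData C.k C.K)
    (h : Nonempty (GaloisMonoidPair.Iso D.tlgPair P)) : IsOpenMap D.aug := by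
  obtain ⟨ι⟩ := h
  exact D.isOpenMap_aug_of_continuousMulEquiv_isTempered hT ι.isoPi

/-! ### §3. The lifting sentences and the schemata for tempered `Π`, unconditionally -/

/-- **`TLG` lifting for TEMPERED `Π`, UNCONDITIONALLY**: every admissible isomorphism of topological
groups between MLF-Galois `TLG`-pairs whose underlying groups are tempered with first-countable
topology lifts to an isomorphism of pairs ((BA) = `biAnabelianUnits_holds` + open augmentation by the
open mapping theorem for tempered groups). [cite: MochizukiAbsTopIII2015, Proposition 3.3 (ii) p.74] -/
theorem tlgLifting_isTempered_holds (P Q : GaloisMonoidPair.{0}) (hP : IsMLFGaloisMonoidPair .TLG P)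
    (hQ : IsMLFGaloisMonoidPair .TLG Q) [FirstCountableTopology P.Pi] [FirstCountableTopology Q.Pi]
    (hPT : SemiGraphs.IsTempered P.Pi) (hQT : SemiGraphs.IsTempered Q.Pi)
    (f : P.Pi ≃ₜ* Q.Pi) (hf : P.actionKer.map f.toMulEquiv.toMonoidHom = Q.actionKer) :
    ∃ e : GaloisMonoidPair.Iso P Q, e.isoPi = f :=
  tlgLifting_openAug_holds P Q hP hQ
    (fun C D h => isOpenMap_aug_of_tlgPair_iso_of_isTempered P hPT C D h)
    (fun C D h => isOpenMap_aug_of_tlgPair_iso_of_isTempered Q hQT C D h) f hf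

/-- **F-0409 `GaloisIsoLiftsToTMPairIso H` UNCONDITIONALLY for every hypothesis predicate `H` under
which `Π` is tempered with first-countable topology** ([AbsTopIII] Prop. 3.2 (iv), author's corrected
form, at the tempered instances that [IUTchI] feeds in at bad places).
[cite: MochizukiAbsTopIII2015, Proposition 3.2 (iv) p.72] [cite: MochizukiAbsTopIIIComments2019, item (5)] -/
theorem galoisIsoLiftsToTMPairIso_of_isTempered_holds (H : GaloisMonoidPair.{0} → Prop)
    (hH : ∀ P, H P → SemiGraphs.IsTempered P.Pi ∧ FirstCountableTopology P.Pi) :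
    Literature.AnabelianGeometry.AbsoluteAnabelian.GaloisIsoLiftsToTMPairIso H :=
  galoisIsoLiftsToTMPairIso_of_openAug_holds H fun P hP C D hι => by
    obtain ⟨hT, hfc⟩ := hH P hP
    exact isOpenMap_aug_of_tmPair_iso_of_isTempered P hT C D hι

/-- **`TCG` lifting UNCONDITIONALLY under tempered-`Π` hypothesis predicates** ([AbsTopIII] Prop. 3.3 (ii)).
[cite: MochizukiAbsTopIII2015, Proposition 3.3 (ii) p.74] -/
theorem tcgLifting_isTempered_holds (H : GaloisMonoidPair.{0} → Prop)
    (hH : ∀ P, H P → SemiGraphs.IsTempered P.Pi ∧ FirstCountableTopology P.Pi)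
    (P Q : GaloisMonoidPair.{0}) (hP : IsMLFGaloisMonoidPair .TCG P) (hQ : IsMLFGaloisMonoidPair .TCG Q)
    (hHP : H P) (hHQ : H Q) (f : P.Pi ≃ₜ* Q.Pi)
    (hf : P.actionKer.map f.toMulEquiv.toMonoidHom = Q.actionKer) :
    ∃ e : GaloisMonoidPair.Iso P Q, e.isoPi = f :=
  tcgLifting_openAug_holds H (fun P hP C D hι => by
    obtain ⟨hT, hfc⟩ := hH P hP
    exact isOpenMap_aug_of_tcgPair_iso_of_isTempered P hT C D hι) P Q hP hQ hHP hHQ f hf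

/-- **F-0413 `UnitPairIsoFibresOfType H` UNCONDITIONALLY for every hypothesis predicate `H` under which
`Π` is tempered with first-countable topology** ([AbsTopIII] Prop. 3.3 (ii) as corrected, both clauses).
[cite: MochizukiAbsTopIII2015, Proposition 3.3 (ii) p.74] [cite: MochizukiAbsTopIIIComments2019, item (5)] -/
theorem unitPairIsoFibresOfType_of_isTempered_holds (H : GaloisMonoidPair.{0} → Prop)
    (hH : ∀ P, H P → SemiGraphs.IsTempered P.Pi ∧ FirstCountableTopology P.Pi) :
    Literature.AnabelianGeometry.AbsoluteAnabelian.UnitPairIsoFibresOfType H :=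
  unitPairIsoFibresOfType_of_openAug_holds H
    (fun P hP C D hι => by
      obtain ⟨hT, hfc⟩ := hH P hP
      exact isOpenMap_aug_of_tcgPair_iso_of_isTempered P hT C D hι)
    (fun P hP C D hι => by
      obtain ⟨hT, hfc⟩ := hH P hP
      exact isOpenMap_aug_of_tlgPair_iso_of_isTempered P hT C D hι)

/-- **The `TLG` two-lift conjunct of F-0412 `UnitPairIsoFibres` for pairs with TEMPERED `Π`,
UNCONDITIONALLY** (pre-erratum Prop. 3.3 (ii), `TLG`: over every admissible `Π ⥲ Π*` there are exactly
two isomorphisms of pairs). [cite: MochizukiAbsTopIII2015, Proposition 3.3 (ii) p.74] -/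
theorem unitPairIsoFibres_tlg_isTempered_holds (P Q : GaloisMonoidPair.{0})
    (hP : IsMLFGaloisMonoidPair .TLG P) (hQ : IsMLFGaloisMonoidPair .TLG Q)
    [FirstCountableTopology P.Pi] [FirstCountableTopology Q.Pi]
    (hPT : SemiGraphs.IsTempered P.Pi) (hQT : SemiGraphs.IsTempered Q.Pi)
    (f : P.Pi ≃ₜ* Q.Pi) (hf : P.actionKer.map f.toMulEquiv.toMonoidHom = Q.actionKer) :
    ∃ e₁ e₂ : GaloisMonoidPair.Iso P Q, e₁.isoPi = f ∧ e₂.isoPi = f ∧ e₁.isoM ≠ e₂.isoM ∧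
      ∀ e : GaloisMonoidPair.Iso P Q, e.isoPi = f → (e.isoM = e₁.isoM ∨ e.isoM = e₂.isoM) :=
  unitPairIsoFibres_tlg_openAug_holds P Q hP hQ
    (fun C D h => isOpenMap_aug_of_tlgPair_iso_of_isTempered P hPT C D h)
    (fun C D h => isOpenMap_aug_of_tlgPair_iso_of_isTempered Q hQT C D h) f hf

/-! ### §4. The profinite first-countable case is an instance -/

/-- Every COMPACT totally disconnected (profinite) `Π_k` is tempered ([SemiAnbd] Rmk. 3.1.1,
`SemiGraphs.IsTempered.of_profinite`), so for first-countable profinite model data the open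
augmentation also follows from the tempered route (étale fundamental groups of hyperbolic orbicurves
over an MLF: "of hyperbolic orbicurve type", Def. 3.1 (ii)). [cite: MochizukiAbsTopIII2015, Definition 3.1 (ii) p.67]
[cite: MochizukiSemiAnbd2006, Rmk 3.1.1 p.33] -/
theorem ModelMLFGaloisData.isOpenMap_aug_of_compact_totallyDisconnected {C : MLFClosure.{0}}
    (D : ModelMLFGaloisData C.k C.K) [CompactSpace D.Pi] [TotallyDisconnectedSpace D.Pi]
    [FirstCountableTopology D.Pi] : IsOpenMap D.aug :=
  D.isOpenMap_aug_of_isTempered SemiGraphs.IsTempered.of_profinite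

/-! ### §5. Pairs whose `Π` is ISOMORPHIC to a tempered group (the shape consumers meet)

A hypothesis predicate `H` describing "pairs arising from a tempered fundamental group" typically
provides an isomorphism of topological groups `P.Pi ≃ₜ* Γ` onto a tempered group `Γ` (e.g. the `Π^tp`
of a `TemperedArithmeticGroup` / `TemperedCurve`), not the literal temperedness of `P.Pi`.  The closers
below take exactly that shape, so no transport of `SemiGraphs.IsTempered` along the isomorphism is
needed (appended by abc-iut-w6-d027, gen 2). -/

/-- Every `TM`-model of a pair whose `Π` is isomorphic, as a topological group, to a tempered group with
first-countable topology has open Galois augmentation. [cite: MochizukiAbsTopIII2015, Definition 3.1 (ii) p.67] -/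
theorem isOpenMap_aug_of_tmPair_iso_of_continuousMulEquiv_isTempered (P : GaloisMonoidPair.{0})
    {Γ : Type} [Group Γ] [TopologicalSpace Γ] [IsTopologicalGroup Γ] [FirstCountableTopology Γ]
    (hT : SemiGraphs.IsTempered Γ) (e : P.Pi ≃ₜ* Γ)
    (C : MLFClosure.{0}) (D : ModelMLFGaloisData C.k C.K)
    (h : Nonempty (GaloisMonoidPair.Iso D.tmPair P)) : IsOpenMap D.aug := by
  obtain ⟨ι⟩ := h
  exact D.isOpenMap_aug_of_continuousMulEquiv_isTempered hT (ι.isoPi.trans e)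

/-- Every `TCG`-model of a pair whose `Π` is isomorphic to a tempered first-countable group has open
Galois augmentation. [cite: MochizukiAbsTopIII2015, Definition 3.1 (ii) p.67] -/
theorem isOpenMap_aug_of_tcgPair_iso_of_continuousMulEquiv_isTempered (P : GaloisMonoidPair.{0})
    {Γ : Type} [Group Γ] [TopologicalSpace Γ] [IsTopologicalGroup Γ] [FirstCountableTopology Γ]
    (hT : SemiGraphs.IsTempered Γ) (e : P.Pi ≃ₜ* Γ)
    (C : MLFClosure.{0}) (D : ModelMLFGaloisData C.k C.K)
    (h : Nonempty (GaloisMonoidPair.Iso D.tcgPair P)) : IsOpenMap D.aug := by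
  obtain ⟨ι⟩ := h
  exact D.isOpenMap_aug_of_continuousMulEquiv_isTempered hT (ι.isoPi.trans e)

/-- Every `TLG`-model of a pair whose `Π` is isomorphic to a tempered first-countable group has open
Galois augmentation. [cite: MochizukiAbsTopIII2015, Definition 3.1 (ii) p.67] -/
theorem isOpenMap_aug_of_tlgPair_iso_of_continuousMulEquiv_isTempered (P : GaloisMonoidPair.{0})
    {Γ : Type} [Group Γ] [TopologicalSpace Γ] [IsTopologicalGroup Γ] [FirstCountableTopology Γ]
    (hT : SemiGraphs.IsTempered Γ) (e : P.Pi ≃ₜ* Γ)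
    (C : MLFClosure.{0}) (D : ModelMLFGaloisData C.k C.K)
    (h : Nonempty (GaloisMonoidPair.Iso D.tlgPair P)) : IsOpenMap D.aug := by
  obtain ⟨ι⟩ := h
  exact D.isOpenMap_aug_of_continuousMulEquiv_isTempered hT (ι.isoPi.trans e)

/-- **`TLG` lifting for pairs whose `Π` is isomorphic to a tempered first-countable group, UNCONDITIONALLY.**
[cite: MochizukiAbsTopIII2015, Proposition 3.3 (ii) p.74] [cite: MochizukiSemiAnbd2006, Ex 3.10 p.43] -/
theorem tlgLifting_of_continuousMulEquiv_isTempered_holds (P Q : GaloisMonoidPair.{0})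
    (hP : IsMLFGaloisMonoidPair .TLG P) (hQ : IsMLFGaloisMonoidPair .TLG Q)
    {Γ₁ : Type} [Group Γ₁] [TopologicalSpace Γ₁] [IsTopologicalGroup Γ₁] [FirstCountableTopology Γ₁]
    {Γ₂ : Type} [Group Γ₂] [TopologicalSpace Γ₂] [IsTopologicalGroup Γ₂] [FirstCountableTopology Γ₂]
    (hT₁ : SemiGraphs.IsTempered Γ₁) (e₁ : P.Pi ≃ₜ* Γ₁) (hT₂ : SemiGraphs.IsTempered Γ₂) (e₂ : Q.Pi ≃ₜ* Γ₂)
    (f : P.Pi ≃ₜ* Q.Pi) (hf : P.actionKer.map f.toMulEquiv.toMonoidHom = Q.actionKer) :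
    ∃ e : GaloisMonoidPair.Iso P Q, e.isoPi = f :=
  tlgLifting_openAug_holds P Q hP hQ
    (fun C D h => isOpenMap_aug_of_tlgPair_iso_of_continuousMulEquiv_isTempered P hT₁ e₁ C D h)
    (fun C D h => isOpenMap_aug_of_tlgPair_iso_of_continuousMulEquiv_isTempered Q hT₂ e₂ C D h) f hf

/-- **F-0409 `GaloisIsoLiftsToTMPairIso H` UNCONDITIONALLY for every hypothesis predicate `H` under which
`Π` is ISOMORPHIC to a tempered group with first-countable topology** (the shape "`(Π ↷ M)` arises from
the tempered fundamental group `Π^tp_X` of [IUTchI] at a bad place").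
[cite: MochizukiAbsTopIII2015, Proposition 3.2 (iv) p.72] [cite: MochizukiAbsTopIIIComments2019, item (5)] -/
theorem galoisIsoLiftsToTMPairIso_of_continuousMulEquiv_isTempered_holds (H : GaloisMonoidPair.{0} → Prop)
    (hH : ∀ P, H P → ∃ (Γ : Type) (_ : Group Γ) (_ : TopologicalSpace Γ) (_ : IsTopologicalGroup Γ)
      (_ : FirstCountableTopology Γ), SemiGraphs.IsTempered Γ ∧ Nonempty (P.Pi ≃ₜ* Γ)) :
    Literature.AnabelianGeometry.AbsoluteAnabelian.GaloisIsoLiftsToTMPairIso H :=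
  galoisIsoLiftsToTMPairIso_of_openAug_holds H fun P hP C D hι => by
    obtain ⟨Γ, _, _, _, _, hT, ⟨e⟩⟩ := hH P hP
    exact isOpenMap_aug_of_tmPair_iso_of_continuousMulEquiv_isTempered P hT e C D hι

/-- **`TCG` lifting UNCONDITIONALLY under "isomorphic to a tempered group" hypothesis predicates**
([AbsTopIII] Prop. 3.3 (ii)). [cite: MochizukiAbsTopIII2015, Proposition 3.3 (ii) p.74] -/
theorem tcgLifting_of_continuousMulEquiv_isTempered_holds (H : GaloisMonoidPair.{0} → Prop)
    (hH : ∀ P, H P → ∃ (Γ : Type) (_ : Group Γ) (_ : TopologicalSpace Γ) (_ : IsTopologicalGroup Γ)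
      (_ : FirstCountableTopology Γ), SemiGraphs.IsTempered Γ ∧ Nonempty (P.Pi ≃ₜ* Γ))
    (P Q : GaloisMonoidPair.{0}) (hP : IsMLFGaloisMonoidPair .TCG P) (hQ : IsMLFGaloisMonoidPair .TCG Q)
    (hHP : H P) (hHQ : H Q) (f : P.Pi ≃ₜ* Q.Pi)
    (hf : P.actionKer.map f.toMulEquiv.toMonoidHom = Q.actionKer) :
    ∃ e : GaloisMonoidPair.Iso P Q, e.isoPi = f :=
  tcgLifting_openAug_holds H (fun P hP C D hι => by
    obtain ⟨Γ, _, _, _, _, hT, ⟨e⟩⟩ := hH P hP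
    exact isOpenMap_aug_of_tcgPair_iso_of_continuousMulEquiv_isTempered P hT e C D hι) P Q hP hQ hHP hHQ f hf

/-- **F-0413 `UnitPairIsoFibresOfType H` UNCONDITIONALLY for every hypothesis predicate `H` under which
`Π` is ISOMORPHIC to a tempered group with first-countable topology** ([AbsTopIII] Prop. 3.3 (ii) as
corrected, both clauses). [cite: MochizukiAbsTopIII2015, Proposition 3.3 (ii) p.74]
[cite: MochizukiAbsTopIIIComments2019, item (5)] -/
theorem unitPairIsoFibresOfType_of_continuousMulEquiv_isTempered_holds (H : GaloisMonoidPair.{0} → Prop)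
    (hH : ∀ P, H P → ∃ (Γ : Type) (_ : Group Γ) (_ : TopologicalSpace Γ) (_ : IsTopologicalGroup Γ)
      (_ : FirstCountableTopology Γ), SemiGraphs.IsTempered Γ ∧ Nonempty (P.Pi ≃ₜ* Γ)) :
    Literature.AnabelianGeometry.AbsoluteAnabelian.UnitPairIsoFibresOfType H :=
  unitPairIsoFibresOfType_of_openAug_holds H
    (fun P hP C D hι => by
      obtain ⟨Γ, _, _, _, _, hT, ⟨e⟩⟩ := hH P hP
      exact isOpenMap_aug_of_tcgPair_iso_of_continuousMulEquiv_isTempered P hT e C D hι)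
    (fun P hP C D hι => by
      obtain ⟨Γ, _, _, _, _, hT, ⟨e⟩⟩ := hH P hP
      exact isOpenMap_aug_of_tlgPair_iso_of_continuousMulEquiv_isTempered P hT e C D hι)

/-- **The `TLG` two-lift conjunct of F-0412 for pairs whose `Π` is isomorphic to a tempered first-countable
group, UNCONDITIONALLY.** [cite: MochizukiAbsTopIII2015, Proposition 3.3 (ii) p.74] -/
theorem unitPairIsoFibres_tlg_of_continuousMulEquiv_isTempered_holds (P Q : GaloisMonoidPair.{0})
    (hP : IsMLFGaloisMonoidPair .TLG P) (hQ : IsMLFGaloisMonoidPair .TLG Q)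
    {Γ₁ : Type} [Group Γ₁] [TopologicalSpace Γ₁] [IsTopologicalGroup Γ₁] [FirstCountableTopology Γ₁]
    {Γ₂ : Type} [Group Γ₂] [TopologicalSpace Γ₂] [IsTopologicalGroup Γ₂] [FirstCountableTopology Γ₂]
    (hT₁ : SemiGraphs.IsTempered Γ₁) (e₁ : P.Pi ≃ₜ* Γ₁) (hT₂ : SemiGraphs.IsTempered Γ₂) (e₂ : Q.Pi ≃ₜ* Γ₂)
    (f : P.Pi ≃ₜ* Q.Pi) (hf : P.actionKer.map f.toMulEquiv.toMonoidHom = Q.actionKer) :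
    ∃ e₁' e₂' : GaloisMonoidPair.Iso P Q, e₁'.isoPi = f ∧ e₂'.isoPi = f ∧ e₁'.isoM ≠ e₂'.isoM ∧
      ∀ e : GaloisMonoidPair.Iso P Q, e.isoPi = f → (e.isoM = e₁'.isoM ∨ e.isoM = e₂'.isoM) :=
  unitPairIsoFibres_tlg_openAug_holds P Q hP hQ
    (fun C D h => isOpenMap_aug_of_tlgPair_iso_of_continuousMulEquiv_isTempered P hT₁ e₁ C D h)
    (fun C D h => isOpenMap_aug_of_tlgPair_iso_of_continuousMulEquiv_isTempered Q hT₂ e₂ C D h) f hf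

end Literature.AnabelianGeometry.AbsoluteAnabelian

end
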